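import Summits.CriticalPhenomena.PercolationContinuityZ3.Theorems.PercNearOneGluingNoHeavyLowerTailGZSeriesGluing
import Summits.CriticalPhenomena.PercolationContinuityZ3.Theorems.PercNearOneGluingNoHeavyLowerTailGZGluingLaw
import HarnessLib

/-!
# `NoHeavyLowerTail` (stmt-CriticalPhenomena-4575) — support file: the SERIES COMPOSITION LAW at measure level
# (prover `prim-ineq-prove-2` gen 11; THEOREM-SP.md §2 (SER))

No definitions, no named facts, no sorries.  Two edge-disjoint sub-networks `E₁` (terminals `a, m`) and `E₂` (terminals
`m, b`) on vertex sets meeting inside `{m, c}` (`a ∉ V₂`, `b ∉ V₁`); events read on `ω ∩ Eᵢ` under `prodBernoulli w` as in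
`GZGluingLaw`.  With `ā₁ = P(a ↮₁ m, a ↮₁ c)`, `b̄₂ = P(m ↮₂ b, b ↮₂ c)`, `n₁ = P₁(a|m|c)`, `n₂ = P₂(m|b|c)`,
`w₁ = P(a ↮₁ c) − ā₁`, `w₂ = P(b ↮₂ c) − b̄₂`:

* `series_law_theta` — `P(a ↔ b off c) = P₁(a ↔ m off c)·P₂(m ↔ b off c)`;
* `series_law_u` — `P(a↮c) = ā₁ + w₁·P₂(m↮c)`;   `series_law_v` — `P(b↮c) = b̄₂ + w₂·P₁(m↮c)`;
* `series_law_z` — `P(a↮c, b↮c) = ā₁b̄₂ + n₁w₂ + w₁n₂ + w₁w₂`;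
* `series_law_n` — `P(a|b|c) = P(a↮c,b↮c) − (P(a↮₁c,m↮₁c) − n₁)(P(m↮₂c,b↮₂c) − n₂)`.
(Independence `GZGluingLaw.real_inter_restrict` + the pointwise identities `GZSeriesGluing.*`.)  The series step of THEOREM SP
for weighted graphs is assembled from these in `PercNearOneGluingNoHeavyLowerTailGZSeriesStep.lean`.
-/

noncomputable section

namespace Summit.CriticalPhenomena.PercolationContinuityZ3.Theorems

open MeasureTheory Literature.Probability.LatticeModels Literature.Probability.Percolation
open scoped Classical

namespace GZSeriesLaw

variable {V : Type*} [Fintype V] {E₁ E₂ : Finset (Sym2 V)} {V₁ V₂ : Set V} {a b m c : V}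

omit [Fintype V] in
/-- Pointwise form of the series gluing: for every configuration `ω`, with `ηᵢ = ω ∩ Eᵢ`,
`a ↮ c ↔ a ↮₁ c ∧ (a ↮₁ m ∨ m ↮₂ c)`, `b ↮ c ↔ b ↮₂ c ∧ (m ↮₂ b ∨ m ↮₁ c)`, and off `c`: `a ~ b ↔ a ~₁ m ∧ m ~₂ b`. [folklore] -/
theorem pointwise (h₁ : ∀ e ∈ (↑E₁ : Set (Sym2 V)), ∀ z ∈ e, z ∈ V₁) (h₂ : ∀ e ∈ (↑E₂ : Set (Sym2 V)), ∀ z ∈ e, z ∈ V₂)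
    (hS : V₁ ∩ V₂ ⊆ {m, c}) (haV₂ : a ∉ V₂) (hbV₁ : b ∉ V₁)
    (ham : a ≠ m) (hac : a ≠ c) (hab : a ≠ b) (hbm : b ≠ m) (hbc : b ≠ c) (hmc : m ≠ c)
    (ω : Set (Sym2 V)) :
    (¬(openGraph (ω ∩ ((↑E₁ : Set (Sym2 V)) ∪ ↑E₂))).Reachable a c ↔ (¬(openGraph (ω ∩ (↑E₁ : Set (Sym2 V)))).Reachable a c ∧ (¬(openGraph (ω ∩ (↑E₁ : Set (Sym2 V)))).Reachable a m ∨ ¬(openGraph (ω ∩ (↑E₂ : Set (Sym2 V)))).Reachable m c))) ∧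
    (¬(openGraph (ω ∩ ((↑E₁ : Set (Sym2 V)) ∪ ↑E₂))).Reachable b c ↔ (¬(openGraph (ω ∩ (↑E₂ : Set (Sym2 V)))).Reachable b c ∧ (¬(openGraph (ω ∩ (↑E₂ : Set (Sym2 V)))).Reachable m b ∨ ¬(openGraph (ω ∩ (↑E₁ : Set (Sym2 V)))).Reachable m c))) ∧
    ((openGraph ((ω ∩ ((↑E₁ : Set (Sym2 V)) ∪ ↑E₂)) \ {e : Sym2 V | c ∈ e})).Reachable a b ↔
      ((openGraph ((ω ∩ (↑E₁ : Set (Sym2 V))) \ {e : Sym2 V | c ∈ e})).Reachable a m ∧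
        (openGraph ((ω ∩ (↑E₂ : Set (Sym2 V))) \ {e : Sym2 V | c ∈ e})).Reachable m b)) := by
  rw [Set.inter_union_distrib_left]
  have k1 := GZSeriesGluing.reach_hub_a_iff (ω₁ := ω ∩ ↑E₁) (ω₂ := ω ∩ ↑E₂) h₁ h₂ hS Set.inter_subset_right
    Set.inter_subset_right haV₂ ham hac
  have k2 := GZSeriesGluing.reach_hub_b_iff (ω₁ := ω ∩ ↑E₁) (ω₂ := ω ∩ ↑E₂) h₁ h₂ hS Set.inter_subset_right
    Set.inter_subset_right hbV₁ hbm hbc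
  have k3 := GZSeriesGluing.reach_off_series_iff (ω₁ := ω ∩ ↑E₁) (ω₂ := ω ∩ ↑E₂) h₁ h₂ hS Set.inter_subset_right
    Set.inter_subset_right haV₂ hbV₁ ham hac hab hbm hbc hmc
  refine ⟨?_, ?_, k3⟩
  · rw [k1]
    constructor
    · intro h
      refine ⟨fun x => h (Or.inl x), ?_⟩
      by_cases hm : (openGraph (ω ∩ ↑E₁)).Reachable a m
      · exact Or.inr (fun y => h (Or.inr ⟨hm, y⟩))
      · exact Or.inl hm
    · rintro ⟨hx, hy⟩ (h | ⟨h', h''⟩)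
      · exact hx h
      · rcases hy with hy | hy
        · exact hy h'
        · exact hy h''
  · rw [k2]
    constructor
    · intro h
      refine ⟨fun x => h (Or.inl x), ?_⟩
      by_cases hm : (openGraph (ω ∩ ↑E₂)).Reachable m b
      · exact Or.inr (fun y => h (Or.inr ⟨hm.symm, y⟩))
      · exact Or.inl hm
    · rintro ⟨hx, hy⟩ (h | ⟨h', h''⟩)
      · exact hx h
      · rcases hy with hy | hy
        · exact hy h'.symm
        · exact hy h''

/-- Independence of an `E₁`-restricted and an `E₂`-restricted event (re-export). [folklore] -/
theorem indep (w : Sym2 V → unitInterval) (hdisj : Disjoint E₁ E₂) (Φ Ψ : Set (Sym2 V) → Prop) :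
    (prodBernoulli w).real ({ω : Set (Sym2 V) | Φ (ω ∩ ↑E₁)} ∩ {ω : Set (Sym2 V) | Ψ (ω ∩ ↑E₂)}) =
      (prodBernoulli w).real {ω : Set (Sym2 V) | Φ (ω ∩ ↑E₁)} * (prodBernoulli w).real {ω : Set (Sym2 V) | Ψ (ω ∩ ↑E₂)} :=
  GZGluingLaw.real_inter_restrict w hdisj Φ Ψ

/-- **Series law for `θ`**: `P(a ↔ b off c) = P₁(a ↔ m off c)·P₂(m ↔ b off c)`. [folklore] -/
theorem series_law_theta (w : Sym2 V → unitInterval) (h₁ : ∀ e ∈ (↑E₁ : Set (Sym2 V)), ∀ z ∈ e, z ∈ V₁) (h₂ : ∀ e ∈ (↑E₂ : Set (Sym2 V)), ∀ z ∈ e, z ∈ V₂)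
    (hS : V₁ ∩ V₂ ⊆ {m, c}) (haV₂ : a ∉ V₂) (hbV₁ : b ∉ V₁)
    (ham : a ≠ m) (hac : a ≠ c) (hab : a ≠ b) (hbm : b ≠ m) (hbc : b ≠ c) (hmc : m ≠ c) (hdisj : Disjoint E₁ E₂) :
    (prodBernoulli w).real {ω : Set (Sym2 V) | (openGraph ((ω ∩ ((↑E₁ : Set (Sym2 V)) ∪ ↑E₂)) \ {e : Sym2 V | c ∈ e})).Reachable a b} =
      (prodBernoulli w).real {ω : Set (Sym2 V) | (openGraph ((ω ∩ (↑E₁ : Set (Sym2 V))) \ {e : Sym2 V | c ∈ e})).Reachable a m} *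
        (prodBernoulli w).real {ω : Set (Sym2 V) | (openGraph ((ω ∩ (↑E₂ : Set (Sym2 V))) \ {e : Sym2 V | c ∈ e})).Reachable m b} := by
  have e : {ω : Set (Sym2 V) | (openGraph ((ω ∩ ((↑E₁ : Set (Sym2 V)) ∪ ↑E₂)) \ {e : Sym2 V | c ∈ e})).Reachable a b} =
      {ω : Set (Sym2 V) | (openGraph ((ω ∩ (↑E₁ : Set (Sym2 V))) \ {e : Sym2 V | c ∈ e})).Reachable a m} ∩
        {ω : Set (Sym2 V) | (openGraph ((ω ∩ (↑E₂ : Set (Sym2 V))) \ {e : Sym2 V | c ∈ e})).Reachable m b} := by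
    ext ω; simp only [Set.mem_inter_iff, Set.mem_setOf_eq]; exact (pointwise h₁ h₂ hS haV₂ hbV₁ ham hac hab hbm hbc hmc ω).2.2
  rw [e]
  exact indep w hdisj (fun η => (openGraph (η \ {e : Sym2 V | c ∈ e})).Reachable a m)
    (fun η => (openGraph (η \ {e : Sym2 V | c ∈ e})).Reachable m b)

/-- `w₁ = P(a ↮₁ c, a ~₁ m) = P(a ↮₁ c) − ā₁`. [folklore] -/
theorem real_W1 (w : Sym2 V → unitInterval) :
    (prodBernoulli w).real {ω : Set (Sym2 V) | ¬(openGraph (ω ∩ (↑E₁ : Set (Sym2 V)))).Reachable a c ∧ (openGraph (ω ∩ (↑E₁ : Set (Sym2 V)))).Reachable a m} =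
      (prodBernoulli w).real {ω : Set (Sym2 V) | ¬(openGraph (ω ∩ (↑E₁ : Set (Sym2 V)))).Reachable a c} -
        (prodBernoulli w).real ({ω : Set (Sym2 V) | ¬(openGraph (ω ∩ (↑E₁ : Set (Sym2 V)))).Reachable a m} ∩ {ω : Set (Sym2 V) | ¬(openGraph (ω ∩ (↑E₁ : Set (Sym2 V)))).Reachable a c}) := by
  have hm : ∀ S : Set (Set (Sym2 V)), MeasurableSet S := fun S => MeasurableSet.of_discrete
  have h := measureReal_inter_add_sdiff (μ := prodBernoulli w) (s := {ω : Set (Sym2 V) | ¬(openGraph (ω ∩ (↑E₁ : Set (Sym2 V)))).Reachable a c}) (t := {ω : Set (Sym2 V) | ¬(openGraph (ω ∩ (↑E₁ : Set (Sym2 V)))).Reachable a m}) (hm _)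
  have cW1 : {ω : Set (Sym2 V) | ¬(openGraph (ω ∩ (↑E₁ : Set (Sym2 V)))).Reachable a c} \ {ω : Set (Sym2 V) | ¬(openGraph (ω ∩ (↑E₁ : Set (Sym2 V)))).Reachable a m} =
      {ω : Set (Sym2 V) | ¬(openGraph (ω ∩ (↑E₁ : Set (Sym2 V)))).Reachable a c ∧ (openGraph (ω ∩ (↑E₁ : Set (Sym2 V)))).Reachable a m} := by ext ω; simp only [Set.mem_sdiff, Set.mem_setOf_eq, not_not]
  rw [Set.inter_comm, cW1] at h
  linarith

/-- `w₂ = P(b ↮₂ c, m ~₂ b) = P(b ↮₂ c) − b̄₂`. [folklore] -/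
theorem real_W2 (w : Sym2 V → unitInterval) :
    (prodBernoulli w).real {ω : Set (Sym2 V) | ¬(openGraph (ω ∩ (↑E₂ : Set (Sym2 V)))).Reachable b c ∧ (openGraph (ω ∩ (↑E₂ : Set (Sym2 V)))).Reachable m b} =
      (prodBernoulli w).real {ω : Set (Sym2 V) | ¬(openGraph (ω ∩ (↑E₂ : Set (Sym2 V)))).Reachable b c} -
        (prodBernoulli w).real ({ω : Set (Sym2 V) | ¬(openGraph (ω ∩ (↑E₂ : Set (Sym2 V)))).Reachable m b} ∩ {ω : Set (Sym2 V) | ¬(openGraph (ω ∩ (↑E₂ : Set (Sym2 V)))).Reachable b c}) := by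
  have hm : ∀ S : Set (Set (Sym2 V)), MeasurableSet S := fun S => MeasurableSet.of_discrete
  have h := measureReal_inter_add_sdiff (μ := prodBernoulli w) (s := {ω : Set (Sym2 V) | ¬(openGraph (ω ∩ (↑E₂ : Set (Sym2 V)))).Reachable b c}) (t := {ω : Set (Sym2 V) | ¬(openGraph (ω ∩ (↑E₂ : Set (Sym2 V)))).Reachable m b}) (hm _)
  have cW2 : {ω : Set (Sym2 V) | ¬(openGraph (ω ∩ (↑E₂ : Set (Sym2 V)))).Reachable b c} \ {ω : Set (Sym2 V) | ¬(openGraph (ω ∩ (↑E₂ : Set (Sym2 V)))).Reachable m b} =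
      {ω : Set (Sym2 V) | ¬(openGraph (ω ∩ (↑E₂ : Set (Sym2 V)))).Reachable b c ∧ (openGraph (ω ∩ (↑E₂ : Set (Sym2 V)))).Reachable m b} := by ext ω; simp only [Set.mem_sdiff, Set.mem_setOf_eq, not_not]
  rw [Set.inter_comm, cW2] at h
  linarith

/-- **Series law for `P(a ↮ c)`**: `P(a↮c) = ā₁ + w₁·P₂(m↮c)`. [folklore] -/
theorem series_law_u (w : Sym2 V → unitInterval) (h₁ : ∀ e ∈ (↑E₁ : Set (Sym2 V)), ∀ z ∈ e, z ∈ V₁) (h₂ : ∀ e ∈ (↑E₂ : Set (Sym2 V)), ∀ z ∈ e, z ∈ V₂)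
    (hS : V₁ ∩ V₂ ⊆ {m, c}) (haV₂ : a ∉ V₂) (hbV₁ : b ∉ V₁)
    (ham : a ≠ m) (hac : a ≠ c) (hab : a ≠ b) (hbm : b ≠ m) (hbc : b ≠ c) (hmc : m ≠ c) (hdisj : Disjoint E₁ E₂) :
    (prodBernoulli w).real {ω : Set (Sym2 V) | ¬(openGraph (ω ∩ ((↑E₁ : Set (Sym2 V)) ∪ ↑E₂))).Reachable a c} =
      (prodBernoulli w).real ({ω : Set (Sym2 V) | ¬(openGraph (ω ∩ (↑E₁ : Set (Sym2 V)))).Reachable a m} ∩ {ω : Set (Sym2 V) | ¬(openGraph (ω ∩ (↑E₁ : Set (Sym2 V)))).Reachable a c}) +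
        ((prodBernoulli w).real {ω : Set (Sym2 V) | ¬(openGraph (ω ∩ (↑E₁ : Set (Sym2 V)))).Reachable a c} -
          (prodBernoulli w).real ({ω : Set (Sym2 V) | ¬(openGraph (ω ∩ (↑E₁ : Set (Sym2 V)))).Reachable a m} ∩ {ω : Set (Sym2 V) | ¬(openGraph (ω ∩ (↑E₁ : Set (Sym2 V)))).Reachable a c})) *
        (prodBernoulli w).real {ω : Set (Sym2 V) | ¬(openGraph (ω ∩ (↑E₂ : Set (Sym2 V)))).Reachable m c} := by
  have hm : ∀ S : Set (Set (Sym2 V)), MeasurableSet S := fun S => MeasurableSet.of_discrete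
  have h := measureReal_inter_add_sdiff (μ := prodBernoulli w) (s := {ω : Set (Sym2 V) | ¬(openGraph (ω ∩ ((↑E₁ : Set (Sym2 V)) ∪ ↑E₂))).Reachable a c}) (t := {ω : Set (Sym2 V) | ¬(openGraph (ω ∩ (↑E₁ : Set (Sym2 V)))).Reachable a m}) (hm _)
  have e1 : {ω : Set (Sym2 V) | ¬(openGraph (ω ∩ ((↑E₁ : Set (Sym2 V)) ∪ ↑E₂))).Reachable a c} ∩ {ω : Set (Sym2 V) | ¬(openGraph (ω ∩ (↑E₁ : Set (Sym2 V)))).Reachable a m} =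
      {ω : Set (Sym2 V) | ¬(openGraph (ω ∩ (↑E₁ : Set (Sym2 V)))).Reachable a m ∧ ¬(openGraph (ω ∩ (↑E₁ : Set (Sym2 V)))).Reachable a c} := by
    ext ω; simp only [Set.mem_inter_iff, Set.mem_setOf_eq]
    have p := (pointwise h₁ h₂ hS haV₂ hbV₁ ham hac hab hbm hbc hmc ω).1
    constructor
    · rintro ⟨hA, hD⟩; exact ⟨hD, (p.1 hA).1⟩
    · rintro ⟨hD, hA1⟩; exact ⟨p.2 ⟨hA1, Or.inl hD⟩, hD⟩
  have e2 : {ω : Set (Sym2 V) | ¬(openGraph (ω ∩ ((↑E₁ : Set (Sym2 V)) ∪ ↑E₂))).Reachable a c} \ {ω : Set (Sym2 V) | ¬(openGraph (ω ∩ (↑E₁ : Set (Sym2 V)))).Reachable a m} =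
      {ω : Set (Sym2 V) | ¬(openGraph (ω ∩ (↑E₁ : Set (Sym2 V)))).Reachable a c ∧ (openGraph (ω ∩ (↑E₁ : Set (Sym2 V)))).Reachable a m} ∩ {ω : Set (Sym2 V) | ¬(openGraph (ω ∩ (↑E₂ : Set (Sym2 V)))).Reachable m c} := by
    ext ω; simp only [Set.mem_sdiff, Set.mem_inter_iff, Set.mem_setOf_eq, not_not]
    have p := (pointwise h₁ h₂ hS haV₂ hbV₁ ham hac hab hbm hbc hmc ω).1
    constructor
    · rintro ⟨hA, hD⟩
      obtain ⟨hA1, hor⟩ := p.1 hA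
      exact ⟨⟨hA1, hD⟩, hor.resolve_left (fun h => h hD)⟩
    · rintro ⟨⟨hA1, hD⟩, hM⟩; exact ⟨p.2 ⟨hA1, Or.inr hM⟩, hD⟩
  rw [e1, e2, indep w hdisj (fun η => ¬(openGraph η).Reachable a c ∧ (openGraph η).Reachable a m)
    (fun η => ¬(openGraph η).Reachable m c), real_W1 w] at h
  have cDA1 : {ω : Set (Sym2 V) | ¬(openGraph (ω ∩ (↑E₁ : Set (Sym2 V)))).Reachable a m} ∩ {ω : Set (Sym2 V) | ¬(openGraph (ω ∩ (↑E₁ : Set (Sym2 V)))).Reachable a c} =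
      {ω : Set (Sym2 V) | ¬(openGraph (ω ∩ (↑E₁ : Set (Sym2 V)))).Reachable a m ∧ ¬(openGraph (ω ∩ (↑E₁ : Set (Sym2 V)))).Reachable a c} := by ext ω; simp only [Set.mem_inter_iff, Set.mem_setOf_eq]
  rw [← cDA1] at h
  linarith

/-- **Series law for `P(b ↮ c)`**: `P(b↮c) = b̄₂ + w₂·P₁(m↮c)`. [folklore] -/
theorem series_law_v (w : Sym2 V → unitInterval) (h₁ : ∀ e ∈ (↑E₁ : Set (Sym2 V)), ∀ z ∈ e, z ∈ V₁) (h₂ : ∀ e ∈ (↑E₂ : Set (Sym2 V)), ∀ z ∈ e, z ∈ V₂)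
    (hS : V₁ ∩ V₂ ⊆ {m, c}) (haV₂ : a ∉ V₂) (hbV₁ : b ∉ V₁)
    (ham : a ≠ m) (hac : a ≠ c) (hab : a ≠ b) (hbm : b ≠ m) (hbc : b ≠ c) (hmc : m ≠ c) (hdisj : Disjoint E₁ E₂) :
    (prodBernoulli w).real {ω : Set (Sym2 V) | ¬(openGraph (ω ∩ ((↑E₁ : Set (Sym2 V)) ∪ ↑E₂))).Reachable b c} =
      (prodBernoulli w).real ({ω : Set (Sym2 V) | ¬(openGraph (ω ∩ (↑E₂ : Set (Sym2 V)))).Reachable m b} ∩ {ω : Set (Sym2 V) | ¬(openGraph (ω ∩ (↑E₂ : Set (Sym2 V)))).Reachable b c}) +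
        ((prodBernoulli w).real {ω : Set (Sym2 V) | ¬(openGraph (ω ∩ (↑E₂ : Set (Sym2 V)))).Reachable b c} -
          (prodBernoulli w).real ({ω : Set (Sym2 V) | ¬(openGraph (ω ∩ (↑E₂ : Set (Sym2 V)))).Reachable m b} ∩ {ω : Set (Sym2 V) | ¬(openGraph (ω ∩ (↑E₂ : Set (Sym2 V)))).Reachable b c})) *
        (prodBernoulli w).real {ω : Set (Sym2 V) | ¬(openGraph (ω ∩ (↑E₁ : Set (Sym2 V)))).Reachable m c} := by
  have hm : ∀ S : Set (Set (Sym2 V)), MeasurableSet S := fun S => MeasurableSet.of_discrete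
  have h := measureReal_inter_add_sdiff (μ := prodBernoulli w) (s := {ω : Set (Sym2 V) | ¬(openGraph (ω ∩ ((↑E₁ : Set (Sym2 V)) ∪ ↑E₂))).Reachable b c}) (t := {ω : Set (Sym2 V) | ¬(openGraph (ω ∩ (↑E₂ : Set (Sym2 V)))).Reachable m b}) (hm _)
  have e1 : {ω : Set (Sym2 V) | ¬(openGraph (ω ∩ ((↑E₁ : Set (Sym2 V)) ∪ ↑E₂))).Reachable b c} ∩ {ω : Set (Sym2 V) | ¬(openGraph (ω ∩ (↑E₂ : Set (Sym2 V)))).Reachable m b} =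
      {ω : Set (Sym2 V) | ¬(openGraph (ω ∩ (↑E₂ : Set (Sym2 V)))).Reachable m b ∧ ¬(openGraph (ω ∩ (↑E₂ : Set (Sym2 V)))).Reachable b c} := by
    ext ω; simp only [Set.mem_inter_iff, Set.mem_setOf_eq]
    have p := (pointwise h₁ h₂ hS haV₂ hbV₁ ham hac hab hbm hbc hmc ω).2.1
    constructor
    · rintro ⟨hB, hD⟩; exact ⟨hD, (p.1 hB).1⟩
    · rintro ⟨hD, hB2⟩; exact ⟨p.2 ⟨hB2, Or.inl hD⟩, hD⟩
  have e2 : {ω : Set (Sym2 V) | ¬(openGraph (ω ∩ ((↑E₁ : Set (Sym2 V)) ∪ ↑E₂))).Reachable b c} \ {ω : Set (Sym2 V) | ¬(openGraph (ω ∩ (↑E₂ : Set (Sym2 V)))).Reachable m b} =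
      {ω : Set (Sym2 V) | ¬(openGraph (ω ∩ (↑E₁ : Set (Sym2 V)))).Reachable m c} ∩ {ω : Set (Sym2 V) | ¬(openGraph (ω ∩ (↑E₂ : Set (Sym2 V)))).Reachable b c ∧ (openGraph (ω ∩ (↑E₂ : Set (Sym2 V)))).Reachable m b} := by
    ext ω; simp only [Set.mem_sdiff, Set.mem_inter_iff, Set.mem_setOf_eq, not_not]
    have p := (pointwise h₁ h₂ hS haV₂ hbV₁ ham hac hab hbm hbc hmc ω).2.1
    constructor
    · rintro ⟨hB, hD⟩
      obtain ⟨hB2, hor⟩ := p.1 hB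
      exact ⟨hor.resolve_left (fun h => h hD), ⟨hB2, hD⟩⟩
    · rintro ⟨hM, ⟨hB2, hD⟩⟩; exact ⟨p.2 ⟨hB2, Or.inr hM⟩, hD⟩
  rw [e1, e2, indep w hdisj (fun η => ¬(openGraph η).Reachable m c)
    (fun η => ¬(openGraph η).Reachable b c ∧ (openGraph η).Reachable m b), real_W2 w] at h
  have cDB2 : {ω : Set (Sym2 V) | ¬(openGraph (ω ∩ (↑E₂ : Set (Sym2 V)))).Reachable m b} ∩ {ω : Set (Sym2 V) | ¬(openGraph (ω ∩ (↑E₂ : Set (Sym2 V)))).Reachable b c} =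
      {ω : Set (Sym2 V) | ¬(openGraph (ω ∩ (↑E₂ : Set (Sym2 V)))).Reachable m b ∧ ¬(openGraph (ω ∩ (↑E₂ : Set (Sym2 V)))).Reachable b c} := by ext ω; simp only [Set.mem_inter_iff, Set.mem_setOf_eq]
  rw [← cDB2] at h
  linarith

/-- **Series law for `P(a ↮ c, b ↮ c)`**: `= ā₁b̄₂ + n₁w₂ + w₁n₂ + w₁w₂`. [folklore] -/
theorem series_law_z (w : Sym2 V → unitInterval) (h₁ : ∀ e ∈ (↑E₁ : Set (Sym2 V)), ∀ z ∈ e, z ∈ V₁) (h₂ : ∀ e ∈ (↑E₂ : Set (Sym2 V)), ∀ z ∈ e, z ∈ V₂)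
    (hS : V₁ ∩ V₂ ⊆ {m, c}) (haV₂ : a ∉ V₂) (hbV₁ : b ∉ V₁)
    (ham : a ≠ m) (hac : a ≠ c) (hab : a ≠ b) (hbm : b ≠ m) (hbc : b ≠ c) (hmc : m ≠ c) (hdisj : Disjoint E₁ E₂) :
    (prodBernoulli w).real ({ω : Set (Sym2 V) | ¬(openGraph (ω ∩ ((↑E₁ : Set (Sym2 V)) ∪ ↑E₂))).Reachable a c} ∩ {ω : Set (Sym2 V) | ¬(openGraph (ω ∩ ((↑E₁ : Set (Sym2 V)) ∪ ↑E₂))).Reachable b c}) =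
      (prodBernoulli w).real ({ω : Set (Sym2 V) | ¬(openGraph (ω ∩ (↑E₁ : Set (Sym2 V)))).Reachable a m} ∩ {ω : Set (Sym2 V) | ¬(openGraph (ω ∩ (↑E₁ : Set (Sym2 V)))).Reachable a c}) *
          (prodBernoulli w).real ({ω : Set (Sym2 V) | ¬(openGraph (ω ∩ (↑E₂ : Set (Sym2 V)))).Reachable m b} ∩ {ω : Set (Sym2 V) | ¬(openGraph (ω ∩ (↑E₂ : Set (Sym2 V)))).Reachable b c}) +
        (prodBernoulli w).real ({ω : Set (Sym2 V) | ¬(openGraph (ω ∩ (↑E₁ : Set (Sym2 V)))).Reachable a m} ∩ {ω : Set (Sym2 V) | ¬(openGraph (ω ∩ (↑E₁ : Set (Sym2 V)))).Reachable a c} ∩ {ω : Set (Sym2 V) | ¬(openGraph (ω ∩ (↑E₁ : Set (Sym2 V)))).Reachable m c}) *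
          ((prodBernoulli w).real {ω : Set (Sym2 V) | ¬(openGraph (ω ∩ (↑E₂ : Set (Sym2 V)))).Reachable b c} -
            (prodBernoulli w).real ({ω : Set (Sym2 V) | ¬(openGraph (ω ∩ (↑E₂ : Set (Sym2 V)))).Reachable m b} ∩ {ω : Set (Sym2 V) | ¬(openGraph (ω ∩ (↑E₂ : Set (Sym2 V)))).Reachable b c})) +
        ((prodBernoulli w).real {ω : Set (Sym2 V) | ¬(openGraph (ω ∩ (↑E₁ : Set (Sym2 V)))).Reachable a c} -
            (prodBernoulli w).real ({ω : Set (Sym2 V) | ¬(openGraph (ω ∩ (↑E₁ : Set (Sym2 V)))).Reachable a m} ∩ {ω : Set (Sym2 V) | ¬(openGraph (ω ∩ (↑E₁ : Set (Sym2 V)))).Reachable a c})) *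
          (prodBernoulli w).real ({ω : Set (Sym2 V) | ¬(openGraph (ω ∩ (↑E₂ : Set (Sym2 V)))).Reachable m b} ∩ {ω : Set (Sym2 V) | ¬(openGraph (ω ∩ (↑E₂ : Set (Sym2 V)))).Reachable m c} ∩ {ω : Set (Sym2 V) | ¬(openGraph (ω ∩ (↑E₂ : Set (Sym2 V)))).Reachable b c}) +
        ((prodBernoulli w).real {ω : Set (Sym2 V) | ¬(openGraph (ω ∩ (↑E₁ : Set (Sym2 V)))).Reachable a c} -
            (prodBernoulli w).real ({ω : Set (Sym2 V) | ¬(openGraph (ω ∩ (↑E₁ : Set (Sym2 V)))).Reachable a m} ∩ {ω : Set (Sym2 V) | ¬(openGraph (ω ∩ (↑E₁ : Set (Sym2 V)))).Reachable a c})) *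
          ((prodBernoulli w).real {ω : Set (Sym2 V) | ¬(openGraph (ω ∩ (↑E₂ : Set (Sym2 V)))).Reachable b c} -
            (prodBernoulli w).real ({ω : Set (Sym2 V) | ¬(openGraph (ω ∩ (↑E₂ : Set (Sym2 V)))).Reachable m b} ∩ {ω : Set (Sym2 V) | ¬(openGraph (ω ∩ (↑E₂ : Set (Sym2 V)))).Reachable b c})) := by
  have hm : ∀ S : Set (Set (Sym2 V)), MeasurableSet S := fun S => MeasurableSet.of_discrete
  have h0 := measureReal_inter_add_sdiff (μ := prodBernoulli w) (s := {ω : Set (Sym2 V) | ¬(openGraph (ω ∩ ((↑E₁ : Set (Sym2 V)) ∪ ↑E₂))).Reachable a c} ∩ {ω : Set (Sym2 V) | ¬(openGraph (ω ∩ ((↑E₁ : Set (Sym2 V)) ∪ ↑E₂))).Reachable b c}) (t := {ω : Set (Sym2 V) | ¬(openGraph (ω ∩ (↑E₁ : Set (Sym2 V)))).Reachable a m}) (hm _)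
  have h1 := measureReal_inter_add_sdiff (μ := prodBernoulli w) (s := ({ω : Set (Sym2 V) | ¬(openGraph (ω ∩ ((↑E₁ : Set (Sym2 V)) ∪ ↑E₂))).Reachable a c} ∩ {ω : Set (Sym2 V) | ¬(openGraph (ω ∩ ((↑E₁ : Set (Sym2 V)) ∪ ↑E₂))).Reachable b c}) ∩ {ω : Set (Sym2 V) | ¬(openGraph (ω ∩ (↑E₁ : Set (Sym2 V)))).Reachable a m}) (t := {ω : Set (Sym2 V) | ¬(openGraph (ω ∩ (↑E₂ : Set (Sym2 V)))).Reachable m b}) (hm _)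
  have h2 := measureReal_inter_add_sdiff (μ := prodBernoulli w) (s := ({ω : Set (Sym2 V) | ¬(openGraph (ω ∩ ((↑E₁ : Set (Sym2 V)) ∪ ↑E₂))).Reachable a c} ∩ {ω : Set (Sym2 V) | ¬(openGraph (ω ∩ ((↑E₁ : Set (Sym2 V)) ∪ ↑E₂))).Reachable b c}) \ {ω : Set (Sym2 V) | ¬(openGraph (ω ∩ (↑E₁ : Set (Sym2 V)))).Reachable a m}) (t := {ω : Set (Sym2 V) | ¬(openGraph (ω ∩ (↑E₂ : Set (Sym2 V)))).Reachable m b}) (hm _)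
  have eS1 : ({ω : Set (Sym2 V) | ¬(openGraph (ω ∩ ((↑E₁ : Set (Sym2 V)) ∪ ↑E₂))).Reachable a c} ∩ {ω : Set (Sym2 V) | ¬(openGraph (ω ∩ ((↑E₁ : Set (Sym2 V)) ∪ ↑E₂))).Reachable b c}) ∩ {ω : Set (Sym2 V) | ¬(openGraph (ω ∩ (↑E₁ : Set (Sym2 V)))).Reachable a m} ∩ {ω : Set (Sym2 V) | ¬(openGraph (ω ∩ (↑E₂ : Set (Sym2 V)))).Reachable m b} =
      {ω : Set (Sym2 V) | ¬(openGraph (ω ∩ (↑E₁ : Set (Sym2 V)))).Reachable a m ∧ ¬(openGraph (ω ∩ (↑E₁ : Set (Sym2 V)))).Reachable a c} ∩ {ω : Set (Sym2 V) | ¬(openGraph (ω ∩ (↑E₂ : Set (Sym2 V)))).Reachable m b ∧ ¬(openGraph (ω ∩ (↑E₂ : Set (Sym2 V)))).Reachable b c} := by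
    ext ω; simp only [Set.mem_inter_iff, Set.mem_setOf_eq]
    have p1 := (pointwise h₁ h₂ hS haV₂ hbV₁ ham hac hab hbm hbc hmc ω).1; have p2 := (pointwise h₁ h₂ hS haV₂ hbV₁ ham hac hab hbm hbc hmc ω).2.1
    constructor
    · rintro ⟨⟨⟨hA, hB⟩, hD1⟩, hD2⟩; exact ⟨⟨hD1, (p1.1 hA).1⟩, ⟨hD2, (p2.1 hB).1⟩⟩
    · rintro ⟨⟨hD1, hA1⟩, ⟨hD2, hB2⟩⟩
      exact ⟨⟨⟨p1.2 ⟨hA1, Or.inl hD1⟩, p2.2 ⟨hB2, Or.inl hD2⟩⟩, hD1⟩, hD2⟩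
  have eS2 : (({ω : Set (Sym2 V) | ¬(openGraph (ω ∩ ((↑E₁ : Set (Sym2 V)) ∪ ↑E₂))).Reachable a c} ∩ {ω : Set (Sym2 V) | ¬(openGraph (ω ∩ ((↑E₁ : Set (Sym2 V)) ∪ ↑E₂))).Reachable b c}) ∩ {ω : Set (Sym2 V) | ¬(openGraph (ω ∩ (↑E₁ : Set (Sym2 V)))).Reachable a m}) \ {ω : Set (Sym2 V) | ¬(openGraph (ω ∩ (↑E₂ : Set (Sym2 V)))).Reachable m b} =
      {ω : Set (Sym2 V) | (¬(openGraph (ω ∩ (↑E₁ : Set (Sym2 V)))).Reachable a m ∧ ¬(openGraph (ω ∩ (↑E₁ : Set (Sym2 V)))).Reachable a c) ∧ ¬(openGraph (ω ∩ (↑E₁ : Set (Sym2 V)))).Reachable m c} ∩ {ω : Set (Sym2 V) | ¬(openGraph (ω ∩ (↑E₂ : Set (Sym2 V)))).Reachable b c ∧ (openGraph (ω ∩ (↑E₂ : Set (Sym2 V)))).Reachable m b} := by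
    ext ω; simp only [Set.mem_inter_iff, Set.mem_sdiff, Set.mem_setOf_eq, not_not]
    have p1 := (pointwise h₁ h₂ hS haV₂ hbV₁ ham hac hab hbm hbc hmc ω).1; have p2 := (pointwise h₁ h₂ hS haV₂ hbV₁ ham hac hab hbm hbc hmc ω).2.1
    constructor
    · rintro ⟨⟨⟨hA, hB⟩, hD1⟩, hD2⟩
      obtain ⟨hB2, hor⟩ := p2.1 hB
      exact ⟨⟨⟨hD1, (p1.1 hA).1⟩, hor.resolve_left (fun h => h hD2)⟩, ⟨hB2, hD2⟩⟩
    · rintro ⟨⟨⟨hD1, hA1⟩, hM1⟩, ⟨hB2, hD2⟩⟩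
      exact ⟨⟨⟨p1.2 ⟨hA1, Or.inl hD1⟩, p2.2 ⟨hB2, Or.inr hM1⟩⟩, hD1⟩, hD2⟩
  have eS3 : (({ω : Set (Sym2 V) | ¬(openGraph (ω ∩ ((↑E₁ : Set (Sym2 V)) ∪ ↑E₂))).Reachable a c} ∩ {ω : Set (Sym2 V) | ¬(openGraph (ω ∩ ((↑E₁ : Set (Sym2 V)) ∪ ↑E₂))).Reachable b c}) \ {ω : Set (Sym2 V) | ¬(openGraph (ω ∩ (↑E₁ : Set (Sym2 V)))).Reachable a m}) ∩ {ω : Set (Sym2 V) | ¬(openGraph (ω ∩ (↑E₂ : Set (Sym2 V)))).Reachable m b} =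
      {ω : Set (Sym2 V) | ¬(openGraph (ω ∩ (↑E₁ : Set (Sym2 V)))).Reachable a c ∧ (openGraph (ω ∩ (↑E₁ : Set (Sym2 V)))).Reachable a m} ∩ {ω : Set (Sym2 V) | (¬(openGraph (ω ∩ (↑E₂ : Set (Sym2 V)))).Reachable m b ∧ ¬(openGraph (ω ∩ (↑E₂ : Set (Sym2 V)))).Reachable m c) ∧ ¬(openGraph (ω ∩ (↑E₂ : Set (Sym2 V)))).Reachable b c} := by
    ext ω; simp only [Set.mem_inter_iff, Set.mem_sdiff, Set.mem_setOf_eq, not_not]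
    have p1 := (pointwise h₁ h₂ hS haV₂ hbV₁ ham hac hab hbm hbc hmc ω).1; have p2 := (pointwise h₁ h₂ hS haV₂ hbV₁ ham hac hab hbm hbc hmc ω).2.1
    constructor
    · rintro ⟨⟨⟨hA, hB⟩, hD1⟩, hD2⟩
      obtain ⟨hA1, hor⟩ := p1.1 hA
      exact ⟨⟨hA1, hD1⟩, ⟨⟨hD2, hor.resolve_left (fun h => h hD1)⟩, (p2.1 hB).1⟩⟩
    · rintro ⟨⟨hA1, hD1⟩, ⟨⟨hD2, hM2⟩, hB2⟩⟩
      exact ⟨⟨⟨p1.2 ⟨hA1, Or.inr hM2⟩, p2.2 ⟨hB2, Or.inl hD2⟩⟩, hD1⟩, hD2⟩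
  have eS4 : (({ω : Set (Sym2 V) | ¬(openGraph (ω ∩ ((↑E₁ : Set (Sym2 V)) ∪ ↑E₂))).Reachable a c} ∩ {ω : Set (Sym2 V) | ¬(openGraph (ω ∩ ((↑E₁ : Set (Sym2 V)) ∪ ↑E₂))).Reachable b c}) \ {ω : Set (Sym2 V) | ¬(openGraph (ω ∩ (↑E₁ : Set (Sym2 V)))).Reachable a m}) \ {ω : Set (Sym2 V) | ¬(openGraph (ω ∩ (↑E₂ : Set (Sym2 V)))).Reachable m b} =
      {ω : Set (Sym2 V) | ¬(openGraph (ω ∩ (↑E₁ : Set (Sym2 V)))).Reachable a c ∧ (openGraph (ω ∩ (↑E₁ : Set (Sym2 V)))).Reachable a m} ∩ {ω : Set (Sym2 V) | ¬(openGraph (ω ∩ (↑E₂ : Set (Sym2 V)))).Reachable b c ∧ (openGraph (ω ∩ (↑E₂ : Set (Sym2 V)))).Reachable m b} := by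
    ext ω; simp only [Set.mem_inter_iff, Set.mem_sdiff, Set.mem_setOf_eq, not_not]
    have p1 := (pointwise h₁ h₂ hS haV₂ hbV₁ ham hac hab hbm hbc hmc ω).1; have p2 := (pointwise h₁ h₂ hS haV₂ hbV₁ ham hac hab hbm hbc hmc ω).2.1
    constructor
    · rintro ⟨⟨⟨hA, hB⟩, hD1⟩, hD2⟩; exact ⟨⟨(p1.1 hA).1, hD1⟩, ⟨(p2.1 hB).1, hD2⟩⟩
    · rintro ⟨⟨hA1, hD1⟩, ⟨hB2, hD2⟩⟩
      have hM1 : ¬(openGraph (ω ∩ (↑E₁ : Set (Sym2 V)))).Reachable m c := fun h => hA1 (hD1.trans h)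
      have hM2 : ¬(openGraph (ω ∩ (↑E₂ : Set (Sym2 V)))).Reachable m c := fun h => hB2 (hD2.symm.trans h)
      exact ⟨⟨⟨p1.2 ⟨hA1, Or.inr hM2⟩, p2.2 ⟨hB2, Or.inr hM1⟩⟩, hD1⟩, hD2⟩
  rw [eS1, indep w hdisj (fun η => ¬(openGraph η).Reachable a m ∧ ¬(openGraph η).Reachable a c)
    (fun η => ¬(openGraph η).Reachable m b ∧ ¬(openGraph η).Reachable b c), eS2,
    indep w hdisj (fun η => (¬(openGraph η).Reachable a m ∧ ¬(openGraph η).Reachable a c) ∧ ¬(openGraph η).Reachable m c)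
    (fun η => ¬(openGraph η).Reachable b c ∧ (openGraph η).Reachable m b)] at h1
  rw [eS3, indep w hdisj (fun η => ¬(openGraph η).Reachable a c ∧ (openGraph η).Reachable a m)
    (fun η => (¬(openGraph η).Reachable m b ∧ ¬(openGraph η).Reachable m c) ∧ ¬(openGraph η).Reachable b c), eS4,
    indep w hdisj (fun η => ¬(openGraph η).Reachable a c ∧ (openGraph η).Reachable a m)
    (fun η => ¬(openGraph η).Reachable b c ∧ (openGraph η).Reachable m b)] at h2
  have cDA1 : {ω : Set (Sym2 V) | ¬(openGraph (ω ∩ (↑E₁ : Set (Sym2 V)))).Reachable a m} ∩ {ω : Set (Sym2 V) | ¬(openGraph (ω ∩ (↑E₁ : Set (Sym2 V)))).Reachable a c} =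
      {ω : Set (Sym2 V) | ¬(openGraph (ω ∩ (↑E₁ : Set (Sym2 V)))).Reachable a m ∧ ¬(openGraph (ω ∩ (↑E₁ : Set (Sym2 V)))).Reachable a c} := by ext ω; simp only [Set.mem_inter_iff, Set.mem_setOf_eq]
  have cDB2 : {ω : Set (Sym2 V) | ¬(openGraph (ω ∩ (↑E₂ : Set (Sym2 V)))).Reachable m b} ∩ {ω : Set (Sym2 V) | ¬(openGraph (ω ∩ (↑E₂ : Set (Sym2 V)))).Reachable b c} =
      {ω : Set (Sym2 V) | ¬(openGraph (ω ∩ (↑E₂ : Set (Sym2 V)))).Reachable m b ∧ ¬(openGraph (ω ∩ (↑E₂ : Set (Sym2 V)))).Reachable b c} := by ext ω; simp only [Set.mem_inter_iff, Set.mem_setOf_eq]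
  have cN1 : {ω : Set (Sym2 V) | ¬(openGraph (ω ∩ (↑E₁ : Set (Sym2 V)))).Reachable a m} ∩ {ω : Set (Sym2 V) | ¬(openGraph (ω ∩ (↑E₁ : Set (Sym2 V)))).Reachable a c} ∩ {ω : Set (Sym2 V) | ¬(openGraph (ω ∩ (↑E₁ : Set (Sym2 V)))).Reachable m c} =
      {ω : Set (Sym2 V) | (¬(openGraph (ω ∩ (↑E₁ : Set (Sym2 V)))).Reachable a m ∧ ¬(openGraph (ω ∩ (↑E₁ : Set (Sym2 V)))).Reachable a c) ∧ ¬(openGraph (ω ∩ (↑E₁ : Set (Sym2 V)))).Reachable m c} := by ext ω; simp only [Set.mem_inter_iff, Set.mem_setOf_eq]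
  have cN2 : {ω : Set (Sym2 V) | ¬(openGraph (ω ∩ (↑E₂ : Set (Sym2 V)))).Reachable m b} ∩ {ω : Set (Sym2 V) | ¬(openGraph (ω ∩ (↑E₂ : Set (Sym2 V)))).Reachable m c} ∩ {ω : Set (Sym2 V) | ¬(openGraph (ω ∩ (↑E₂ : Set (Sym2 V)))).Reachable b c} =
      {ω : Set (Sym2 V) | (¬(openGraph (ω ∩ (↑E₂ : Set (Sym2 V)))).Reachable m b ∧ ¬(openGraph (ω ∩ (↑E₂ : Set (Sym2 V)))).Reachable m c) ∧ ¬(openGraph (ω ∩ (↑E₂ : Set (Sym2 V)))).Reachable b c} := by ext ω; simp only [Set.mem_inter_iff, Set.mem_setOf_eq]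
  rw [real_W2 w, ← cDA1, ← cDB2, ← cN1] at h1
  rw [real_W1 w, real_W2 w, ← cN2] at h2
  linarith

/-- **Series law for `P(a|b|c)`**: `P(a|b|c) = P(a↮c,b↮c) − w₁'w₂'` with `w₁' = P(a↮₁c,m↮₁c) − P₁(a|m|c)`,
`w₂' = P(m↮₂c,b↮₂c) − P₂(m|b|c)`. [folklore] -/
theorem series_law_n (w : Sym2 V → unitInterval) (h₁ : ∀ e ∈ (↑E₁ : Set (Sym2 V)), ∀ z ∈ e, z ∈ V₁) (h₂ : ∀ e ∈ (↑E₂ : Set (Sym2 V)), ∀ z ∈ e, z ∈ V₂)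
    (hS : V₁ ∩ V₂ ⊆ {m, c}) (haV₂ : a ∉ V₂) (hbV₁ : b ∉ V₁)
    (ham : a ≠ m) (hac : a ≠ c) (hab : a ≠ b) (hbm : b ≠ m) (hbc : b ≠ c) (hmc : m ≠ c) (hdisj : Disjoint E₁ E₂) :
    (prodBernoulli w).real ({ω : Set (Sym2 V) | ¬(openGraph (ω ∩ ((↑E₁ : Set (Sym2 V)) ∪ ↑E₂))).Reachable a b} ∩ {ω : Set (Sym2 V) | ¬(openGraph (ω ∩ ((↑E₁ : Set (Sym2 V)) ∪ ↑E₂))).Reachable a c} ∩ {ω : Set (Sym2 V) | ¬(openGraph (ω ∩ ((↑E₁ : Set (Sym2 V)) ∪ ↑E₂))).Reachable b c}) =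
      (prodBernoulli w).real ({ω : Set (Sym2 V) | ¬(openGraph (ω ∩ ((↑E₁ : Set (Sym2 V)) ∪ ↑E₂))).Reachable a c} ∩ {ω : Set (Sym2 V) | ¬(openGraph (ω ∩ ((↑E₁ : Set (Sym2 V)) ∪ ↑E₂))).Reachable b c}) -
        ((prodBernoulli w).real ({ω : Set (Sym2 V) | ¬(openGraph (ω ∩ (↑E₁ : Set (Sym2 V)))).Reachable a c} ∩ {ω : Set (Sym2 V) | ¬(openGraph (ω ∩ (↑E₁ : Set (Sym2 V)))).Reachable m c}) -
            (prodBernoulli w).real ({ω : Set (Sym2 V) | ¬(openGraph (ω ∩ (↑E₁ : Set (Sym2 V)))).Reachable a m} ∩ {ω : Set (Sym2 V) | ¬(openGraph (ω ∩ (↑E₁ : Set (Sym2 V)))).Reachable a c} ∩ {ω : Set (Sym2 V) | ¬(openGraph (ω ∩ (↑E₁ : Set (Sym2 V)))).Reachable m c})) *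
          ((prodBernoulli w).real ({ω : Set (Sym2 V) | ¬(openGraph (ω ∩ (↑E₂ : Set (Sym2 V)))).Reachable m c} ∩ {ω : Set (Sym2 V) | ¬(openGraph (ω ∩ (↑E₂ : Set (Sym2 V)))).Reachable b c}) -
            (prodBernoulli w).real ({ω : Set (Sym2 V) | ¬(openGraph (ω ∩ (↑E₂ : Set (Sym2 V)))).Reachable m b} ∩ {ω : Set (Sym2 V) | ¬(openGraph (ω ∩ (↑E₂ : Set (Sym2 V)))).Reachable m c} ∩ {ω : Set (Sym2 V) | ¬(openGraph (ω ∩ (↑E₂ : Set (Sym2 V)))).Reachable b c})) := by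
  have hm : ∀ S : Set (Set (Sym2 V)), MeasurableSet S := fun S => MeasurableSet.of_discrete
  have eN : {ω : Set (Sym2 V) | ¬(openGraph (ω ∩ ((↑E₁ : Set (Sym2 V)) ∪ ↑E₂))).Reachable a b} ∩ {ω : Set (Sym2 V) | ¬(openGraph (ω ∩ ((↑E₁ : Set (Sym2 V)) ∪ ↑E₂))).Reachable a c} ∩ {ω : Set (Sym2 V) | ¬(openGraph (ω ∩ ((↑E₁ : Set (Sym2 V)) ∪ ↑E₂))).Reachable b c} =
      ({ω : Set (Sym2 V) | ¬(openGraph (ω ∩ ((↑E₁ : Set (Sym2 V)) ∪ ↑E₂))).Reachable a c} ∩ {ω : Set (Sym2 V) | ¬(openGraph (ω ∩ ((↑E₁ : Set (Sym2 V)) ∪ ↑E₂))).Reachable b c}) \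
        ({ω : Set (Sym2 V) | ¬(openGraph (ω ∩ (↑E₁ : Set (Sym2 V)))).Reachable a c ∧ (openGraph ((ω ∩ (↑E₁ : Set (Sym2 V))) \ {e : Sym2 V | c ∈ e})).Reachable a m} ∩ {ω : Set (Sym2 V) | ¬(openGraph (ω ∩ (↑E₂ : Set (Sym2 V)))).Reachable b c ∧ (openGraph ((ω ∩ (↑E₂ : Set (Sym2 V))) \ {e : Sym2 V | c ∈ e})).Reachable m b}) := by
    ext ω
    have h1 := (pointwise h₁ h₂ hS haV₂ hbV₁ ham hac hab hbm hbc hmc ω).1; have h2 := (pointwise h₁ h₂ hS haV₂ hbV₁ ham hac hab hbm hbc hmc ω).2.1; have h3 := (pointwise h₁ h₂ hS haV₂ hbV₁ ham hac hab hbm hbc hmc ω).2.2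
    simp only [Set.mem_inter_iff, Set.mem_sdiff, Set.mem_setOf_eq]
    constructor
    · rintro ⟨⟨hDω, hAω⟩, hBω⟩
      refine ⟨⟨hAω, hBω⟩, fun hW => hDω ?_⟩
      exact (h3.2 ⟨hW.1.2, hW.2.2⟩).mono (openGraph_mono Set.sdiff_subset)
    · rintro ⟨⟨hAω, hBω⟩, hW⟩
      refine ⟨⟨fun hab' => hW ?_, hAω⟩, hBω⟩
      have hoff := h3.1 (GZGluingLaw.reach_off_of_reach hab' hAω)
      exact ⟨⟨(h1.1 hAω).1, hoff.1⟩, ⟨(h2.1 hBω).1, hoff.2⟩⟩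
  have hsub : {ω : Set (Sym2 V) | ¬(openGraph (ω ∩ (↑E₁ : Set (Sym2 V)))).Reachable a c ∧ (openGraph ((ω ∩ (↑E₁ : Set (Sym2 V))) \ {e : Sym2 V | c ∈ e})).Reachable a m} ∩ {ω : Set (Sym2 V) | ¬(openGraph (ω ∩ (↑E₂ : Set (Sym2 V)))).Reachable b c ∧ (openGraph ((ω ∩ (↑E₂ : Set (Sym2 V))) \ {e : Sym2 V | c ∈ e})).Reachable m b} ⊆
      {ω : Set (Sym2 V) | ¬(openGraph (ω ∩ ((↑E₁ : Set (Sym2 V)) ∪ ↑E₂))).Reachable a c} ∩ {ω : Set (Sym2 V) | ¬(openGraph (ω ∩ ((↑E₁ : Set (Sym2 V)) ∪ ↑E₂))).Reachable b c} := by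
    intro ω hω
    have h1 := (pointwise h₁ h₂ hS haV₂ hbV₁ ham hac hab hbm hbc hmc ω).1; have h2 := (pointwise h₁ h₂ hS haV₂ hbV₁ ham hac hab hbm hbc hmc ω).2.1
    simp only [Set.mem_inter_iff, Set.mem_setOf_eq] at h1 h2 hω ⊢
    refine ⟨h1.2 ⟨hω.1.1, Or.inr ?_⟩, h2.2 ⟨hω.2.1, Or.inr ?_⟩⟩
    · intro hmc'
      exact hω.2.1 (((hω.2.2.mono (openGraph_mono Set.sdiff_subset)).symm).trans hmc')
    · intro hmc'
      exact hω.1.1 ((hω.1.2.mono (openGraph_mono Set.sdiff_subset)).trans hmc')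
  have eAT1 : {ω : Set (Sym2 V) | ¬(openGraph (ω ∩ (↑E₁ : Set (Sym2 V)))).Reachable a c ∧ (openGraph ((ω ∩ (↑E₁ : Set (Sym2 V))) \ {e : Sym2 V | c ∈ e})).Reachable a m} =
      ({ω : Set (Sym2 V) | ¬(openGraph (ω ∩ (↑E₁ : Set (Sym2 V)))).Reachable a c} ∩ {ω : Set (Sym2 V) | ¬(openGraph (ω ∩ (↑E₁ : Set (Sym2 V)))).Reachable m c}) \ ({ω : Set (Sym2 V) | ¬(openGraph (ω ∩ (↑E₁ : Set (Sym2 V)))).Reachable a m} ∩ {ω : Set (Sym2 V) | ¬(openGraph (ω ∩ (↑E₁ : Set (Sym2 V)))).Reachable a c} ∩ {ω : Set (Sym2 V) | ¬(openGraph (ω ∩ (↑E₁ : Set (Sym2 V)))).Reachable m c}) := by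
    ext ω
    simp only [Set.mem_inter_iff, Set.mem_sdiff, Set.mem_setOf_eq]
    constructor
    · rintro ⟨hA', hT'⟩
      have ham' : (openGraph (ω ∩ (↑E₁ : Set (Sym2 V)))).Reachable a m := hT'.mono (openGraph_mono Set.sdiff_subset)
      exact ⟨⟨hA', fun h => hA' (ham'.trans h)⟩, fun h => h.1.1 ham'⟩
    · rintro ⟨⟨hA', hM'⟩, hN⟩
      refine ⟨hA', ?_⟩
      have ham' : (openGraph (ω ∩ (↑E₁ : Set (Sym2 V)))).Reachable a m := by
        by_contra h; exact hN ⟨⟨h, hA'⟩, hM'⟩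
      exact GZGluingLaw.reach_off_of_reach ham' hA'
  have eBT2 : {ω : Set (Sym2 V) | ¬(openGraph (ω ∩ (↑E₂ : Set (Sym2 V)))).Reachable b c ∧ (openGraph ((ω ∩ (↑E₂ : Set (Sym2 V))) \ {e : Sym2 V | c ∈ e})).Reachable m b} =
      ({ω : Set (Sym2 V) | ¬(openGraph (ω ∩ (↑E₂ : Set (Sym2 V)))).Reachable m c} ∩ {ω : Set (Sym2 V) | ¬(openGraph (ω ∩ (↑E₂ : Set (Sym2 V)))).Reachable b c}) \ ({ω : Set (Sym2 V) | ¬(openGraph (ω ∩ (↑E₂ : Set (Sym2 V)))).Reachable m b} ∩ {ω : Set (Sym2 V) | ¬(openGraph (ω ∩ (↑E₂ : Set (Sym2 V)))).Reachable m c} ∩ {ω : Set (Sym2 V) | ¬(openGraph (ω ∩ (↑E₂ : Set (Sym2 V)))).Reachable b c}) := by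
    ext ω
    simp only [Set.mem_inter_iff, Set.mem_sdiff, Set.mem_setOf_eq]
    constructor
    · rintro ⟨hB', hT'⟩
      have hmb' : (openGraph (ω ∩ (↑E₂ : Set (Sym2 V)))).Reachable m b := hT'.mono (openGraph_mono Set.sdiff_subset)
      exact ⟨⟨fun h => hB' (hmb'.symm.trans h), hB'⟩, fun h => h.1.1 hmb'⟩
    · rintro ⟨⟨hM', hB'⟩, hN⟩
      refine ⟨hB', ?_⟩
      have hmb' : (openGraph (ω ∩ (↑E₂ : Set (Sym2 V)))).Reachable m b := by
        by_contra h; exact hN ⟨⟨h, hM'⟩, hB'⟩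
      exact GZGluingLaw.reach_off_of_reach hmb' hM'
  have mW12 : (prodBernoulli w).real ({ω : Set (Sym2 V) | ¬(openGraph (ω ∩ (↑E₁ : Set (Sym2 V)))).Reachable a c ∧ (openGraph ((ω ∩ (↑E₁ : Set (Sym2 V))) \ {e : Sym2 V | c ∈ e})).Reachable a m} ∩ {ω : Set (Sym2 V) | ¬(openGraph (ω ∩ (↑E₂ : Set (Sym2 V)))).Reachable b c ∧ (openGraph ((ω ∩ (↑E₂ : Set (Sym2 V))) \ {e : Sym2 V | c ∈ e})).Reachable m b}) =
      (prodBernoulli w).real {ω : Set (Sym2 V) | ¬(openGraph (ω ∩ (↑E₁ : Set (Sym2 V)))).Reachable a c ∧ (openGraph ((ω ∩ (↑E₁ : Set (Sym2 V))) \ {e : Sym2 V | c ∈ e})).Reachable a m} *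
        (prodBernoulli w).real {ω : Set (Sym2 V) | ¬(openGraph (ω ∩ (↑E₂ : Set (Sym2 V)))).Reachable b c ∧ (openGraph ((ω ∩ (↑E₂ : Set (Sym2 V))) \ {e : Sym2 V | c ∈ e})).Reachable m b} :=
    indep w hdisj (fun η => ¬(openGraph η).Reachable a c ∧ (openGraph (η \ {e : Sym2 V | c ∈ e})).Reachable a m)
      (fun η => ¬(openGraph η).Reachable b c ∧ (openGraph (η \ {e : Sym2 V | c ∈ e})).Reachable m b)
  have mAT1 : (prodBernoulli w).real {ω : Set (Sym2 V) | ¬(openGraph (ω ∩ (↑E₁ : Set (Sym2 V)))).Reachable a c ∧ (openGraph ((ω ∩ (↑E₁ : Set (Sym2 V))) \ {e : Sym2 V | c ∈ e})).Reachable a m} =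
      (prodBernoulli w).real ({ω : Set (Sym2 V) | ¬(openGraph (ω ∩ (↑E₁ : Set (Sym2 V)))).Reachable a c} ∩ {ω : Set (Sym2 V) | ¬(openGraph (ω ∩ (↑E₁ : Set (Sym2 V)))).Reachable m c}) -
        (prodBernoulli w).real ({ω : Set (Sym2 V) | ¬(openGraph (ω ∩ (↑E₁ : Set (Sym2 V)))).Reachable a m} ∩ {ω : Set (Sym2 V) | ¬(openGraph (ω ∩ (↑E₁ : Set (Sym2 V)))).Reachable a c} ∩ {ω : Set (Sym2 V) | ¬(openGraph (ω ∩ (↑E₁ : Set (Sym2 V)))).Reachable m c}) := by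
    rw [eAT1]; exact measureReal_sdiff (fun ω hω => ⟨hω.1.2, hω.2⟩) (hm _)
  have mBT2 : (prodBernoulli w).real {ω : Set (Sym2 V) | ¬(openGraph (ω ∩ (↑E₂ : Set (Sym2 V)))).Reachable b c ∧ (openGraph ((ω ∩ (↑E₂ : Set (Sym2 V))) \ {e : Sym2 V | c ∈ e})).Reachable m b} =
      (prodBernoulli w).real ({ω : Set (Sym2 V) | ¬(openGraph (ω ∩ (↑E₂ : Set (Sym2 V)))).Reachable m c} ∩ {ω : Set (Sym2 V) | ¬(openGraph (ω ∩ (↑E₂ : Set (Sym2 V)))).Reachable b c}) -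
        (prodBernoulli w).real ({ω : Set (Sym2 V) | ¬(openGraph (ω ∩ (↑E₂ : Set (Sym2 V)))).Reachable m b} ∩ {ω : Set (Sym2 V) | ¬(openGraph (ω ∩ (↑E₂ : Set (Sym2 V)))).Reachable m c} ∩ {ω : Set (Sym2 V) | ¬(openGraph (ω ∩ (↑E₂ : Set (Sym2 V)))).Reachable b c}) := by
    rw [eBT2]; exact measureReal_sdiff (fun ω hω => ⟨hω.1.2, hω.2⟩) (hm _)
  rw [eN, measureReal_sdiff hsub (hm _), mW12, mAT1, mBT2]

end GZSeriesLaw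

end Summit.CriticalPhenomena.PercolationContinuityZ3.Theorems
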